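import Mathlib
import HarnessLib
import Summits.HubbardSuperconductivity.HubbardSuperconductivity.Theorems.WeakCouplingBCSWcbcsBcsConstructionLadderShellGeometryFn

/-!
# Crux `CwChiralConstruction` (stmt-HubbardSuperconductivity-1740), line `ladder-scale-transfer`:
# stub (Gw) `stub_ladderShellGeometryWide` — shell geometry of the ladder-scale record on the wide level range

The ladder-scale certificate `symmetricRegimeCertificateT U ν (ladderScaleData s hs) ladderTolerance K Λ L₀` has the
continuum shell-geometry conjunct `ShellGeometry (renormalisedBandC ν K) Λ (1/2) 4 (1/25) 3 (1/2)` (squared Fermi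
speed in `[1/4, 16]`, level-line curvature in `[1/25, 3]` in absolute value, distance `≥ 1/2` from the van Hove
points, on the whole continuum shell `{p ∈ [-π,π]² : |e_K(p)| ≤ Λ}`). The sibling crux `WcbcsBcsConstruction` proved
it for `ν ∈ [-9/10, -3/10]` (`stub_ladderShellGeometryFn`, via `shell_jet_bounds` on the level sums
`S = cos p₁ + cos p₂ ∈ [139/1000, 461/1000]`). Here the level range is the whole chiral window `ν ∈ [-2, -3/10]`,
on whose shells (`Λ ≤ 1/50`, counterterm `≤ 1/500` pointwise) `S ∈ [139/1000, 1011/1000]`. The only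
range-dependent step of the sibling argument — the lower bound `21/20 ≤ N₀` on the bare curvature numerator
`N₀ = 8S(1 - P)`, `P = cos p₁ cos p₂ ≤ S²/4` — is redone on the wide range (split at `S = 461/1000`); everything
else (`|∇e|² = 4(2 - S² + 2P) ∈ [1.034, 8]` from `P ≥ S - 1`, `N₀ ≤ 2|∇e|²`, frame perturbations `≤ 1/50` and
`≤ 2/25`, curvature bounds in squared form, van Hove distance from `S ≥ 139/1000`) is the sibling's, verbatim.
Reference: Feldman–Knörrer–Trubowitz, CMP 247 (2004) §1 (the geometric hypotheses on the Fermi curve).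
-/

noncomputable section

-- the tree's namespace `Summit.<Summit>.<Problem>.Theorems` repeats the summit name by design (D-0017)
set_option linter.dupNamespace false

namespace Summit.HubbardSuperconductivity.HubbardSuperconductivity.Theorems

open Literature.MathematicalPhysics.QuantumLattice Literature.Probability.LatticeModels

/-! ### The algebraic core on the wide range of level sums -/

/-- **Jet bounds on the shell, wide range.** For `s₀² + C₀² = s₁² + C₁² = 1`, `S = C₀ + C₁ ∈ [139/1000, 1011/1000]`
and frame jets `a₀, a₁, b₀₀, b₀₁, b₁₁` of size `≤ 1/500`, the squared speed `G = (2s₀ - a₀)² + (2s₁ - a₁)²` and the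
curvature numerator `N = (2C₀ - b₀₀)(2s₁ - a₁)² - 2(0 - b₀₁)(2s₀ - a₀)(2s₁ - a₁) + (2C₁ - b₁₁)(2s₀ - a₀)²` satisfy
`1/4 ≤ G ≤ 16`, `0 < N`, `N² ≤ 9 G³`, `G³ ≤ 625 N²` (the twin of `shell_jet_bounds`, whose range of level sums is
`[139/1000, 461/1000]`). [folklore] -/
theorem klGw_shell_jet_bounds {C₀ C₁ s₀ s₁ a₀ a₁ b₀₀ b₀₁ b₁₁ G N : ℝ}
    (h0 : s₀ ^ 2 + C₀ ^ 2 = 1) (h1 : s₁ ^ 2 + C₁ ^ 2 = 1)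
    (hSlo : (139 : ℝ) / 1000 ≤ C₀ + C₁) (hShi : C₀ + C₁ ≤ (1011 : ℝ) / 1000)
    (ha₀ : |a₀| ≤ 1 / 500) (ha₁ : |a₁| ≤ 1 / 500) (hb₀₀ : |b₀₀| ≤ 1 / 500) (hb₀₁ : |b₀₁| ≤ 1 / 500)
    (hb₁₁ : |b₁₁| ≤ 1 / 500)
    (hG : G = (2 * s₀ - a₀) ^ 2 + (2 * s₁ - a₁) ^ 2)
    (hN : N = (2 * C₀ - b₀₀) * (2 * s₁ - a₁) ^ 2 - 2 * (0 - b₀₁) * (2 * s₀ - a₀) * (2 * s₁ - a₁) +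
      (2 * C₁ - b₁₁) * (2 * s₀ - a₀) ^ 2) :
    (1 / 2 : ℝ) ^ 2 ≤ G ∧ G ≤ (4 : ℝ) ^ 2 ∧ 0 < G ∧ 0 < N ∧ N ^ 2 ≤ 9 * G ^ 3 ∧ G ^ 3 ≤ 625 * N ^ 2 := by
  -- adapted from `shell_jet_bounds` (Theorems/WeakCouplingBCSWcbcsBcsConstructionLadderShellGeometry.lean)
  -- unit bounds
  have hC₀ : |C₀| ≤ 1 := by
    rw [← sq_le_one_iff_abs_le_one]; nlinarith [sq_nonneg s₀]
  have hC₁ : |C₁| ≤ 1 := by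
    rw [← sq_le_one_iff_abs_le_one]; nlinarith [sq_nonneg s₁]
  have hs₀ : |s₀| ≤ 1 := by
    rw [← sq_le_one_iff_abs_le_one]; nlinarith [sq_nonneg C₀]
  have hs₁ : |s₁| ≤ 1 := by
    rw [← sq_le_one_iff_abs_le_one]; nlinarith [sq_nonneg C₁]
  have hC₀' := abs_le.1 hC₀
  have hC₁' := abs_le.1 hC₁
  -- the bare jets
  set S := C₀ + C₁ with hS
  set G₀ := 4 * (s₀ ^ 2 + s₁ ^ 2) with hG₀
  set N₀ := 8 * (C₀ * s₁ ^ 2 + C₁ * s₀ ^ 2) with hN₀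
  have hG₀eq : G₀ = 4 * (2 - S ^ 2 + 2 * (C₀ * C₁)) := by
    rw [hG₀, hS]; linear_combination 4 * h0 + 4 * h1
  have hN₀eq : N₀ = 8 * S * (1 - C₀ * C₁) := by
    rw [hN₀, hS]
    have e0 : s₀ ^ 2 = 1 - C₀ ^ 2 := by linarith
    have e1 : s₁ ^ 2 = 1 - C₁ ^ 2 := by linarith
    rw [e0, e1]; ring
  have hQ : 0 ≤ (1 - C₀) * (1 - C₁) := mul_nonneg (by linarith [hC₀'.2]) (by linarith [hC₁'.2])
  have hQeq : (1 - C₀) * (1 - C₁) = 1 - S + C₀ * C₁ := by rw [hS]; ring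
  have hPlo : S - 1 ≤ C₀ * C₁ := by linarith
  have hPhi : C₀ * C₁ ≤ S ^ 2 / 4 := by
    have : S ^ 2 - 4 * (C₀ * C₁) = (C₀ - C₁) ^ 2 := by rw [hS]; ring
    nlinarith [sq_nonneg (C₀ - C₁)]
  -- G₀ ∈ [1.0347, 8]
  have hG₀lo : (258679 : ℝ) / 250000 ≤ G₀ := by
    have hwin : 0 ≤ (S - 139 / 1000) * (1861 / 1000 - S) := mul_nonneg (by linarith) (by linarith)
    have hwin' : (S - 139 / 1000) * (1861 / 1000 - S) = -S ^ 2 + 2 * S - 258679 / 1000000 := by ring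
    rw [hG₀eq]; linarith
  have hG₀hi : G₀ ≤ 8 := by
    rw [hG₀]; linarith [sq_nonneg C₀, sq_nonneg C₁]
  -- N₀ ∈ [1.05, 2 G₀]; the lower bound `21/20 ≤ 8S - 2S³` on `[0.139, 1.011]` is taken on the two halves
  -- `S ≤ 461/1000` (the sibling's range) and `461/1000 ≤ S` separately
  have hSpos : 0 ≤ S := by linarith
  have hN₀lo : (21 : ℝ) / 20 ≤ N₀ := by
    have h3 : 8 * S * (C₀ * C₁) ≤ 8 * S * (S ^ 2 / 4) := mul_le_mul_of_nonneg_left hPhi (by linarith)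
    have h6 : 8 * S * (S ^ 2 / 4) = 2 * (S * S ^ 2) := by ring
    have h7 : 8 * S * (1 - C₀ * C₁) = 8 * S - 8 * S * (C₀ * C₁) := by ring
    rw [hN₀eq, h7]
    rcases le_total S (461 / 1000) with hSmid | hSmid
    · have h4 : S ^ 2 ≤ (461 / 1000 : ℝ) ^ 2 := pow_le_pow_left₀ hSpos hSmid 2
      have h5 : S * S ^ 2 ≤ S * (461 / 1000 : ℝ) ^ 2 := mul_le_mul_of_nonneg_left h4 hSpos
      linarith only [h3, h5, h6, hSlo]
    · have h4 : S ^ 2 ≤ (1011 / 1000 : ℝ) ^ 2 := pow_le_pow_left₀ hSpos hShi 2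
      have h5 : S * S ^ 2 ≤ S * (1011 / 1000 : ℝ) ^ 2 := mul_le_mul_of_nonneg_left h4 hSpos
      linarith only [h3, h5, h6, hSmid]
  have hN₀hi : N₀ ≤ 2 * G₀ := by
    have e : 2 * G₀ - N₀ = 8 * ((2 + S) * ((1 - C₀) * (1 - C₁))) := by rw [hG₀eq, hN₀eq, hQeq]; ring
    have : 0 ≤ (2 + S) * ((1 - C₀) * (1 - C₁)) := mul_nonneg (by linarith) hQ
    linarith
  -- the perturbations
  have hGpert : |G - G₀| ≤ 1 / 50 := by
    have e : G - G₀ = (a₀ ^ 2 - 4 * s₀ * a₀) + (a₁ ^ 2 - 4 * s₁ * a₁) := by rw [hG, hG₀]; ring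
    rw [e]
    calc |(a₀ ^ 2 - 4 * s₀ * a₀) + (a₁ ^ 2 - 4 * s₁ * a₁)|
        ≤ |a₀ ^ 2 - 4 * s₀ * a₀| + |a₁ ^ 2 - 4 * s₁ * a₁| := abs_add_le _ _
      _ ≤ 1 / 100 + 1 / 100 := add_le_add (abs_sq_sub_four_mul_le hs₀ ha₀) (abs_sq_sub_four_mul_le hs₁ ha₁)
      _ = 1 / 50 := by norm_num
  have hNpert : |N - N₀| ≤ 2 / 25 := by
    have e : N - N₀ = ((2 * C₀ - b₀₀) * (2 * s₁ - a₁) ^ 2 - 8 * C₀ * s₁ ^ 2) +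
        (-(2 * (0 - b₀₁) * (2 * s₀ - a₀) * (2 * s₁ - a₁))) +
        ((2 * C₁ - b₁₁) * (2 * s₀ - a₀) ^ 2 - 8 * C₁ * s₀ ^ 2) := by rw [hN, hN₀]; ring
    rw [e]
    calc _ ≤ |((2 * C₀ - b₀₀) * (2 * s₁ - a₁) ^ 2 - 8 * C₀ * s₁ ^ 2) +
          (-(2 * (0 - b₀₁) * (2 * s₀ - a₀) * (2 * s₁ - a₁)))| +
          |(2 * C₁ - b₁₁) * (2 * s₀ - a₀) ^ 2 - 8 * C₁ * s₀ ^ 2| := abs_add_le _ _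
      _ ≤ (|(2 * C₀ - b₀₀) * (2 * s₁ - a₁) ^ 2 - 8 * C₀ * s₁ ^ 2| +
          |(-(2 * (0 - b₀₁) * (2 * s₀ - a₀) * (2 * s₁ - a₁)))|) +
          |(2 * C₁ - b₁₁) * (2 * s₀ - a₀) ^ 2 - 8 * C₁ * s₀ ^ 2| :=
          add_le_add (abs_add_le _ _) le_rfl
      _ ≤ (3 / 100 + 1 / 50) + 3 / 100 := by
          refine add_le_add (add_le_add (abs_diag_pert_le hC₀ hs₁ ha₁ hb₀₀) ?_)
            (abs_diag_pert_le hC₁ hs₀ ha₀ hb₁₁)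
          rw [abs_neg]
          exact abs_mixed_pert_le hs₀ hs₁ ha₀ ha₁ hb₀₁
      _ = 2 / 25 := by norm_num
  have hGp := abs_le.1 hGpert
  have hNp := abs_le.1 hNpert
  -- consequences
  have hGlo : (1 : ℝ) ≤ G := by linarith
  have hGhi : G ≤ 401 / 50 := by linarith
  have hNlo : (97 : ℝ) / 100 ≤ N := by linarith
  have hNhi : N ≤ 2 * G + 3 / 25 := by linarith
  have hGpos : 0 < G := by linarith
  have hNpos : 0 < N := by linarith
  refine ⟨by linarith, by linarith, hGpos, hNpos, ?_, ?_⟩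
  · -- N² ≤ (2G + 3/25)² ≤ 9 G³ on G ≥ 1
    have hsq : N ^ 2 ≤ (2 * G + 3 / 25) ^ 2 := pow_le_pow_left₀ hNpos.le hNhi 2
    have hsq' : (2 * G + 3 / 25) ^ 2 = 4 * G ^ 2 + 12 / 25 * G + 9 / 625 := by ring
    have hG1 : (1 : ℝ) * G ≤ G ^ 2 := by
      have : G ^ 2 = G * G := by ring
      rw [this]; exact mul_le_mul_of_nonneg_right hGlo hGpos.le
    have hG2 : (1 : ℝ) * G ^ 2 ≤ G ^ 3 := by
      have : G ^ 3 = G * G ^ 2 := by ring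
      rw [this]; exact mul_le_mul_of_nonneg_right hGlo (sq_nonneg G)
    linarith only [hsq, hsq', hG1, hG2, hGlo]
  · -- G³ ≤ (401/50)³ ≤ 625 (97/100)² ≤ 625 N²
    have hG3 : G ^ 3 ≤ (401 / 50 : ℝ) ^ 3 := pow_le_pow_left₀ hGpos.le hGhi 3
    have hN2 : ((97 : ℝ) / 100) ^ 2 ≤ N ^ 2 := pow_le_pow_left₀ (by norm_num) hNlo 2
    linarith only [hG3, hN2]

/-! ### The shell geometry of a countertermed band with a `C²`-small counterterm, wide level range -/

/-- **Shell geometry on the wide level range for a `C²`-small counterterm (function form).** If `F` is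
differentiable with `DF(p)v = F₀(p)v₀ + F₁(p)v₁`, `DF₀(p)v = F₀₀(p)v₀ + F₀₁(p)v₁`, `DF₁(p)v = F₁₀(p)v₀ + F₁₁(p)v₁`
everywhere and `|F|, |F₀|, |F₁|, |F₀₀|, |F₁₀|, |F₁₁| ≤ 1/500` pointwise, then for `ν ∈ [-2, -3/10]` and `Λ ≤ 1/50`
the band `p ↦ -2(cos p₁ + cos p₂) - ν - F(p)` satisfies `ShellGeometry · Λ (1/2) 4 (1/25) 3 (1/2)` (the wide-range
twin of `shellGeometry_band_of_small_C2`). [folklore] -/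
theorem klGw_shellGeometry_band_of_small_C2 {ν : ℝ} (hν : ν ∈ Set.Icc (-(2 : ℝ)) (-(3 : ℝ) / 10))
    {F F₀ F₁ F₀₀ F₀₁ F₁₀ F₁₁ : (Fin 2 → ℝ) → ℝ}
    (hFd : ∀ p, DifferentiableAt ℝ F p) (hF : ∀ p v, fderiv ℝ F p v = F₀ p * v 0 + F₁ p * v 1)
    (hF₀d : ∀ p, DifferentiableAt ℝ F₀ p) (hF₀ : ∀ p v, fderiv ℝ F₀ p v = F₀₀ p * v 0 + F₀₁ p * v 1)
    (hF₁d : ∀ p, DifferentiableAt ℝ F₁ p) (hF₁ : ∀ p v, fderiv ℝ F₁ p v = F₁₀ p * v 0 + F₁₁ p * v 1)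
    (bF : ∀ p, |F p| ≤ 1 / 500) (bF₀ : ∀ p, |F₀ p| ≤ 1 / 500) (bF₁ : ∀ p, |F₁ p| ≤ 1 / 500)
    (bF₀₀ : ∀ p, |F₀₀ p| ≤ 1 / 500) (bF₁₀ : ∀ p, |F₁₀ p| ≤ 1 / 500) (bF₁₁ : ∀ p, |F₁₁ p| ≤ 1 / 500)
    {Λ : ℝ} (hΛ : Λ ≤ 1 / 50) :
    ShellGeometry (fun p : Fin 2 → ℝ => -2 * (Real.cos (p 0) + Real.cos (p 1)) - ν - F p)
      Λ (1 / 2) 4 (1 / 25) 3 (1 / 2) := by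
  -- adapted from `shellGeometry_band_of_small_C2` (Theorems/WeakCouplingBCSWcbcsBcsConstructionLadderShellGeometryFn.lean)
  intro p _ hpΛ
  -- jets of the band: bare minus counterterm
  have he : ∀ p v, fderiv ℝ (fun p : Fin 2 → ℝ => -2 * (Real.cos (p 0) + Real.cos (p 1)) - ν - F p) p v =
      (fun p => 2 * Real.sin (p 0) - F₀ p) p * v 0 + (fun p => 2 * Real.sin (p 1) - F₁ p) p * v 1 := by
    intro p v
    have h := (fderiv_bareBand ν p).1.hasFDerivAt.fun_sub (hFd p).hasFDerivAt
    rw [h.fderiv, FunLike.coe_sub, Pi.sub_apply, (fderiv_bareBand ν p).2 v, hF p v]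
    ring
  have h₀ : ∀ p v, fderiv ℝ (fun p : Fin 2 → ℝ => 2 * Real.sin (p 0) - F₀ p) p v =
      (fun p => 2 * Real.cos (p 0) - F₀₀ p) p * v 0 + (fun p => 0 - F₀₁ p) p * v 1 := by
    intro p v
    have h := (fderiv_two_mul_sin_coord 0 p).1.hasFDerivAt.fun_sub (hF₀d p).hasFDerivAt
    rw [h.fderiv, FunLike.coe_sub, Pi.sub_apply, (fderiv_two_mul_sin_coord 0 p).2 v, hF₀ p v]
    ring
  have h₁ : ∀ p v, fderiv ℝ (fun p : Fin 2 → ℝ => 2 * Real.sin (p 1) - F₁ p) p v =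
      (fun p => 0 - F₁₀ p) p * v 0 + (fun p => 2 * Real.cos (p 1) - F₁₁ p) p * v 1 := by
    intro p v
    have h := (fderiv_two_mul_sin_coord 1 p).1.hasFDerivAt.fun_sub (hF₁d p).hasFDerivAt
    rw [h.fderiv, FunLike.coe_sub, Pi.sub_apply, (fderiv_two_mul_sin_coord 1 p).2 v, hF₁ p v]
    ring
  have hGeq := gradSq_of_fderiv he p
  have hκeq := levelCurvature_of_fderiv he h₀ h₁ p
  -- the shell pins `S = cos p₀ + cos p₁` in `[139/1000, 1011/1000]`
  have hshell := abs_le.1 hpΛ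
  have hk' := abs_le.1 (bF p)
  have hSlo : (139 : ℝ) / 1000 ≤ Real.cos (p 0) + Real.cos (p 1) := by
    have := hshell.2; simp only at this; linarith [hν.2]
  have hShi : Real.cos (p 0) + Real.cos (p 1) ≤ (1011 : ℝ) / 1000 := by
    have := hshell.1; simp only at this; linarith [hν.1]
  obtain ⟨hG1, hG2, hGpos, hNpos, hN1, hN2⟩ := klGw_shell_jet_bounds (Real.sin_sq_add_cos_sq (p 0))
    (Real.sin_sq_add_cos_sq (p 1)) hSlo hShi (bF₀ p) (bF₁ p) (bF₀₀ p) (bF₁₀ p) (bF₁₁ p) rfl rfl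
  refine ⟨?_, ?_, vanHove_dist_of_level hSlo⟩
  · rw [hGeq]; exact ⟨hG1, hG2⟩
  · rw [hκeq]; exact curvature_bounds_of_sq hGpos hNpos hN1 hN2

/-- **Stub (Gw) `stub_ladderShellGeometryWide` of line `ladder-scale-transfer`** (crux `CwChiralConstruction`,
stmt-HubbardSuperconductivity-1740; registered signature): the shell-geometry conjunct
`ShellGeometry (renormalisedBandC ν K) Λ (1/2) 4 (1/25) 3 (1/2)` of the ladder-scale certificate holds for every
chemical potential `ν` in the whole chiral level window `[-2, -3/10]`, every frame `K : TrigPolyC4v` whose values and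
first and second partial derivatives are pointwise `≤ 1/500` in absolute value, and every scale `Λ ≤ 1/50` — the
wide-range extension of the sibling's `stub_ladderShellGeometryFn` (`ν ∈ [-9/10, -3/10]`).
[cite: FeldmanKnorrerTrubowitz2004, §1] -/
theorem stub_ladderShellGeometryWide :
    ∀ ν ∈ Set.Icc (-(2:ℝ)) (-(3:ℝ) / 10), ∀ K : TrigPolyC4v,
      (∀ p : Fin 2 → ℝ, |K.eval p| ≤ 1 / 500 ∧ |partialD 0 K.eval p| ≤ 1 / 500 ∧ |partialD 1 K.eval p| ≤ 1 / 500 ∧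
        |partialD 0 (partialD 0 K.eval) p| ≤ 1 / 500 ∧ |partialD 0 (partialD 1 K.eval) p| ≤ 1 / 500 ∧
        |partialD 1 (partialD 1 K.eval) p| ≤ 1 / 500) →
      ∀ Λ : ℝ, Λ ≤ 1 / 50 → ShellGeometry (renormalisedBandC ν K) Λ (1 / 2) 4 (1 / 25) 3 (1 / 2) := by
  -- adapted from `stub_ladderShellGeometryFn` (Theorems/WeakCouplingBCSWcbcsBcsConstructionLadderShellGeometryFn.lean)
  intro ν hν K hK Λ hΛ
  have hsm : ContDiff ℝ ⊤ (fun p : Fin 2 → ℝ => K.eval p) := contDiff_frame_eval K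
  have hsm' : ContDiff ℝ ⊤ K.eval := hsm
  have h0 : ContDiff ℝ ⊤ (partialD 0 K.eval) := contDiff_partialD hsm' 0
  have h1 : ContDiff ℝ ⊤ (partialD 1 K.eval) := contDiff_partialD hsm' 1
  have hband : renormalisedBandC ν K = fun p : Fin 2 → ℝ =>
      -2 * (Real.cos (p 0) + Real.cos (p 1)) - ν - K.eval p := by
    funext p; rfl
  rw [hband]
  exact klGw_shellGeometry_band_of_small_C2 hν
    (fun p => hsm'.differentiable (by simp) p) (fun p v => fderiv_apply_eq_partialD _ p v)
    (fun p => h0.differentiable (by simp) p) (fun p v => fderiv_apply_eq_partialD _ p v)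
    (fun p => h1.differentiable (by simp) p) (fun p v => fderiv_apply_eq_partialD _ p v)
    (fun p => (hK p).1) (fun p => (hK p).2.1) (fun p => (hK p).2.2.1) (fun p => (hK p).2.2.2.1)
    (fun p => (hK p).2.2.2.2.1) (fun p => (hK p).2.2.2.2.2) hΛ

end Summit.HubbardSuperconductivity.HubbardSuperconductivity.Theorems

end
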